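import Summits.CriticalPhenomena.Ising3DConformalLimit.Theses.PerfectScreening
import Summits.CriticalPhenomena.Ising3DConformalLimit.Theorems.PerfectScreeningSubharmonicOffOriginShellSplitGlue

/-!
# Line `certified-core-eventual-tail`, SHELL RESHAPE — skeleton for crux `SubharmonicOffOrigin`
(stmt-CriticalPhenomena-1341; lead prover-line-stmt-CriticalPhenomena-1341-c2-0, 2026-08-17)

Crux (route `PerfectScreening`, rank 2): `SubH := ∀ x ≠ 0, 6·G(x) ≤ Σᵢ (G(x+eᵢ) + G(x−eᵢ))`,
`G = criticalTwoPoint 3 = ⟨σ₀σ_x⟩⁺_{β_c(3)}`.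

The round-1 line `certified-core-eventual-tail` split the crux at the sup-norm radius
`coreRadius = 2` into a CORE `0 < ‖x‖∞ ≤ 2` (`stub_core_certificate`, a β-uniform dual certificate
of the lattice positivity bootstrap) and a TAIL `‖x‖∞ ≥ 3` (`stub_farField`).  This reshape keeps
that composition idea and follows the crux-strategist's prepared shell decomposition
(`Cruxes/SubharmonicOffOrigin/STRATEGY-CENSUS.md` §6 D1, `ShellSplitChildren.md`), whose glue is
LANDED (`Theorems.PerfectScreening.ShellSplit.subharmonicOffOrigin_of_shells`, exact equivalence
`subharmonicOffOrigin_iff_shells`): the core becomes the two shells `‖x‖∞ = 1` and `‖x‖∞ = 2`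
(different difficulty classes: certificate ≈ 4× resp. 10–50× beyond the printed LP frontier), the
tail is the FAR SHELL verbatim.  Stubs (registered; the ONLY `sorry`s of this file):

* `stub_shellOne`  — SubH at the 3 site classes of sup-norm 1 (`ShellOne` of the prepared split);
* `stub_shellTwo`  — SubH at the 6 site classes of sup-norm 2 (`ShellTwo`);
* `stub_farShell`  — SubH at every site of sup-norm ≥ 3 (`FarShell`: the open infrared core —
  quantitative η(3) > 0 with corrections-to-scaling control of lattice second differences).

Composition `SubharmonicOffOrigin_of : PerfectScreening.SubharmonicOffOrigin` = the landed glue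
applied to the three stubs (the crux BY NAME).  Disproof.lean honoured: `x ≠ 0` is carried by
`stub_shellOne` and implied in the other two shells; no uniform slack is claimed anywhere
(`not_uniformlyStrictSubharmonic`); the far shell is exactly where exact balance
(`tendsto_nbrSum_div_of_subharmonicOffOrigin`, `AxisBalance.tendsto_nbrSum_div_shiftedAxis`) bites.
-/

noncomputable section

namespace Summit.CriticalPhenomena.Ising3DConformalLimit.Cruxes.SubharmonicOffOrigin.CertifiedCoreEventualTail

open Literature.Probability.LatticeModels
open Summit.CriticalPhenomena.Ising3DConformalLimit.Theorems.PerfectScreening.ShellSplit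

/-! ### Registered stubs (`sorry` lives ONLY here) -/

/-- **Stub 1 — FIRST SHELL** (`ShellOne`, `[difficulty: computation]`): SubH at the sites of
sup-norm `1`: `(1,0,0)`: `1 + G(200) + 4G(110) ≥ 6G(100)`; `(1,1,0)`: `2G(100) + 2G(210) + 2G(111)
≥ 6G(110)`; `(1,1,1)`: `3G(110) + 3G(211) ≥ 6G(111)` (MC margins `1.4e-2, 4.6e-3, ≈3e-3`; `(1,0,0)`
conditional on `InverseMFerromagnet ∧ PrecisionIsLaplacian`, `Dcs.subH_unitSteps_of_IM_of_PIL`). -/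
theorem stub_shellOne :
    ∀ x : Site 3, x ≠ 0 → (∀ j : Fin 3, (x j).natAbs ≤ 1) →
      6 * criticalTwoPoint 3 x ≤
        ∑ i : Fin 3, (criticalTwoPoint 3 (x + Pi.single i 1) + criticalTwoPoint 3 (x - Pi.single i 1)) := by
  sorry

/-- **Stub 2 — SECOND SHELL** (`ShellTwo`, `[difficulty: computation]`): SubH at the six site classes
of sup-norm `2` — `(2,0,0)`, `(2,1,0)`, `(2,1,1)`, `(2,2,0)`, `(2,2,1)`, `(2,2,2)` (MC margins
`≈ 1e-3 … 2e-3`; β-uniform SDP certificate 10–50× beyond the printed lattice-bootstrap frontier). -/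
theorem stub_shellTwo :
    ∀ x : Site 3, (∀ j : Fin 3, (x j).natAbs ≤ 2) → (∃ j : Fin 3, (x j).natAbs = 2) →
      6 * criticalTwoPoint 3 x ≤
        ∑ i : Fin 3, (criticalTwoPoint 3 (x + Pi.single i 1) + criticalTwoPoint 3 (x - Pi.single i 1)) := by
  sorry

/-- **Stub 3 — FAR SHELL** (`FarShell`, `[difficulty: open-problem]`, the hard core of the crux):
SubH at every site with a coordinate of modulus `≥ 3`: effective eventual subharmonicity with radius
`2` — the infrared fine structure of `G` at `β_c(3)` (`ΔG ≈ Aη(1+η)r^{-3-η}(1 + O(r^{-ω})) > 0`: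
quantitative `η(3) > 0` with corrections-to-scaling control at the level of discrete second
differences). -/
theorem stub_farShell :
    ∀ x : Site 3, (∃ j : Fin 3, 2 < (x j).natAbs) →
      6 * criticalTwoPoint 3 x ≤
        ∑ i : Fin 3, (criticalTwoPoint 3 (x + Pi.single i 1) + criticalTwoPoint 3 (x - Pi.single i 1)) := by
  sorry

/-! ### Composition (sorry-free glue, landed) -/

/-- **THE LINE'S SKELETON THEOREM**: the crux `SubharmonicOffOrigin` BY NAME from the three shells,
by the landed glue `ShellSplit.subharmonicOffOrigin_of_shells` (trichotomy on `‖x‖∞ ∈ {1}, {2},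
[3, ∞)` for `x ≠ 0`). Its only `sorry`s are the stubs'. -/
theorem SubharmonicOffOrigin_of :
    Summit.CriticalPhenomena.Ising3DConformalLimit.Theses.PerfectScreening.SubharmonicOffOrigin :=
  subharmonicOffOrigin_of_shells stub_shellOne stub_shellTwo stub_farShell

end Summit.CriticalPhenomena.Ising3DConformalLimit.Cruxes.SubharmonicOffOrigin.CertifiedCoreEventualTail
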